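import Literature.NumberTheory.EllipticCurves.LocalTatePairingTateModule
import Literature.NumberTheory.EllipticCurves.LocalKummerMap
import HarnessLib

/-!
# The `ℤ_p`-valued local Tate pairing of `H¹(F, T_pW)` with POINTS `E(F)`: `⟨x, κ P⟩ = (⟨pr_k x, κ_{p^k} P⟩)_k`

Topic `NumberTheory/EllipticCurves`; namespace `Literature.NumberTheory.EllipticCurves`. Sequel of
`LocalTatePairingTateModule.lean` (brick K2 floor (c) of the hT₂ programme of crux K★ stmt-BirchSwinnertonDyer-22226, memo
`Summits/BirchSwinnertonDyer/BirchSwinnertonDyer/Cruxes/StarredOptimalManinUnitFiveSeven/Lines/kato-lever-hT2-programme.md` §4):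
floor (c′). Definitions with bodies and theorems; no named fact, no instance, nothing is assumed.

The pairing `H¹(F, T_pW) × E(F) → ℤ_p`, `(x, P) ↦ ⟨x, κ(P)⟩` (local Tate pairing with the Kummer image) is built
WITHOUT a `T`-adic Kummer map: at each level `p^k` the tree's LOCAL KUMMER MAP on `F`-rational points
`WeierstrassCurve.localKummerMap W F hn : E(F) →+ H¹(F, E[p^k]|_{Γ_F})` (`LocalKummerMap.lean`: `κ_{p^k}(P) = [σ ↦ σ Q_k − Q_k]`,
`p^k Q_k = P`, root `localZSMulRoot`, root-independence `localKummerMap_eq_localKummerClass`, exactness `range_localKummerMap` /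
`ker_localKummerMap`) is paired with `pr_k x` by the level pairing `⟨·,·⟩_{p^k, inv_{p^k}}` of `LocalTateSelfDualityTorsion.lean`;
the Kummer classes are COMPATIBLE along `p : E[p^{k+1}] → E[p^k]` (`cohomologyMap_torsionMulMor_kummerLevelClass`: `p Q_{k+1}` is a
`p^k`-th root), so by floor (b) the values are coherent and define a `p`-adic integer.

* `kummerLevelClass W F p k := W.localKummerMap F _` at the `ℕ`-level `p^k` of `torsionRestricted` (a one-line wrapper; `rfl` bridge
  `kummerLevelClass_eq_localKummerMap`), `kummerLevelClass_add`, ★ `cohomologyMap_torsionMulMor_kummerLevelClass` (compatibility in `k`);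
* `tatePointLevelValue`, `castHom_tatePointLevelValue_succ` (coherence), and ★★ **`tatePairingPoint :
  H¹(F, T_pW|_{Γ_F}) →+ E(F) →+ ℤ_p`** with `toZModPow_tatePairingPoint : ⟨x, P⟩ mod p^k = ⟨pr_k x, κ_{p^k} P⟩_{p^k}`;
* `tatePairing_eq_tatePairingPoint` — if `y ∈ H¹(F, T_pW)` has `pr_k y = κ_{p^k}(P)` for all `k` (a `T`-adic Kummer class
  of `P`), then `⟨x, y⟩ = ⟨x, P⟩` (floor (c)'s `tatePairing`).

This is the object of the reciprocity law [REC] (Kato II Thm 1.4.1: `⟨x, κ P⟩ = ± Tr_{F/ℚ_p}(e · exp*_ω(x) · log_ω P)`) and of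
[TD]/[SAT] («every additive `E(F) → ℤ_p` is `⟨x, ·⟩`») of the memo; neither is proved here. BSD is not proved by any of this.

## References
* J. H. Silverman, *The Arithmetic of Elliptic Curves*, 2nd ed. 2009, VIII §2 (Kummer pairing), X §4. [SilvermanAEC2009]
* J. Neukirch, A. Schmidt, K. Wingberg, *Cohomology of Number Fields*, 2008, (7.2.6). [NeukirchSchmidtWingberg2008]
* K. Kato, LNM 1553 (1993), Ch. II §1.4. [Kato1993LNM1553]
* S. Bloch, K. Kato (1990), §3 Prop. 3.8 (the pairing `H¹(K,T) × H¹(K, T ⊗ ℚ/ℤ(1))`). [BlochKato1990]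
-/

noncomputable section

open scoped Classical

open CategoryTheory Function Field
open Literature.NumberTheory.GaloisRepresentations
open Literature.NumberTheory.GaloisRepresentations.DiscreteGaloisModule (mu MuCarrier)
open Literature.NumberTheory.PAdicHodge (restrictedTateRep restrictedTateRep_apply_apply)
open Literature.AnabelianGeometry.AbsoluteAnabelian (Prop121vii.invLevel)

namespace Literature.NumberTheory.EllipticCurves

open _root_.WeierstrassCurve

attribute [local instance] absoluteGaloisGroup_compactSpace
attribute [local instance] finite_geomTorsion_of_neZero

-- universe-monomorphic, as `PAdicHodge.restrictedTateRep`
variable {K₀ : Type} [Field K₀] [CharZero K₀] (W : WeierstrassCurve K₀) [W.IsElliptic] (F : Type) [Field F]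
  [Algebra K₀ F] (p : ℕ) [hp : Fact p.Prime]

/-- `p^k ≠ 0`: instance bookkeeping for the levels. [folklore] -/
private theorem neZero_pow' (k : ℕ) : NeZero (p ^ k) := ⟨pow_ne_zero k hp.out.ne_zero⟩

attribute [local instance] neZero_pow'

omit [CharZero K₀] [W.IsElliptic] in
/-- `p^k ≠ 0` in `ℤ` (the `hn` of the tree's `localKummerClass`). [folklore] -/
private theorem pow_ne_zero_int (k : ℕ) : ((p ^ k : ℕ) : ℤ) ≠ 0 := by
  exact_mod_cast pow_ne_zero k hp.out.ne_zero

/-! ### The level-`p^k` Kummer classes of a rational point -/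

/-- **The level-`p^k` local Kummer class `κ_{p^k}(P) ∈ H¹(F, E[p^k]|_{Γ_F})`** of an `F`-rational point: the tree's
`WeierstrassCurve.localKummerMap` (`LocalKummerMap.lean`) at the `ℕ`-level `p^k` of `torsionRestricted` (one-line wrapper, `rfl` bridge
`kummerLevelClass_eq_localKummerMap`; the tree's root-independence, range and kernel theorems apply verbatim). [cite: SilvermanAEC2009, VIII §2] -/
def kummerLevelClass (k : ℕ) (P : (W.baseChange F).toAffine.Point) :
    continuousCohomology 1 (torsionRestricted W F (p ^ k)).toTopRep :=
  W.localKummerMap F (pow_ne_zero_int p k) P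

/-- `kummerLevelClass` IS the tree's `localKummerMap` at level `p^k` (by `rfl`). [cite: SilvermanAEC2009, VIII §2] -/
theorem kummerLevelClass_eq_localKummerMap (k : ℕ) (P : (W.baseChange F).toAffine.Point) :
    kummerLevelClass W F p k P = W.localKummerMap F (pow_ne_zero_int p k) P := rfl

/-- `κ_{p^k}(P)` is the local Kummer class of ANY `p^k`-th root of (the image `e(P)` in `E(F̄)` of) `P`
(`localKummerMap_eq_localKummerClass`). [cite: SilvermanAEC2009, VIII §2] -/
theorem kummerLevelClass_eq_localKummerClass (k : ℕ) (P : (W.baseChange F).toAffine.Point) (Q : localPoints W F)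
    (hQ : ((p ^ k : ℕ) : ℤ) • Q = W.baseChangeGeomPointsEquiv F (toGeomPoints (W.baseChange F) P)) :
    kummerLevelClass W F p k P =
      W.localKummerClass ((p ^ k : ℕ) : ℤ) (pow_ne_zero_int p k) Q (W.zsmul_mem_fixedPoints_of_eq F hQ) :=
  W.localKummerMap_eq_localKummerClass F (pow_ne_zero_int p k) P Q _ hQ

/-- **`κ_{p^k}` is additive in `P`** (it is the additive map `localKummerMap`). [cite: SilvermanAEC2009, VIII §2] -/
theorem kummerLevelClass_add (k : ℕ) (P P' : (W.baseChange F).toAffine.Point) :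
    kummerLevelClass W F p k (P + P') = kummerLevelClass W F p k P + kummerLevelClass W F p k P' :=
  map_add (W.localKummerMap F (pow_ne_zero_int p k)) P P'

/-- ★ **Compatibility of the Kummer classes along `p : E[p^{k+1}] → E[p^k]`**: `p_* κ_{p^{k+1}}(P) = κ_{p^k}(P)`
(`p Q_{k+1}` is a `p^k`-th root of `P`, and `p (σ Q − Q) = σ(pQ) − pQ`). [cite: SilvermanAEC2009, VIII §2] -/
theorem cohomologyMap_torsionMulMor_kummerLevelClass (k : ℕ) (P : (W.baseChange F).toAffine.Point) :
    (cohomologyMap (torsionMulMor W F (p ^ (k + 1)) (p ^ k) p (pow_succ p k).symm) 1).hom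
        (kummerLevelClass W F p (k + 1) P) =
      kummerLevelClass W F p k P := by
  -- `p • Q_{k+1}` is a `p^k`-th root of `P`
  have hroot : ((p ^ k : ℕ) : ℤ) • ((p : ℤ) • W.localZSMulRoot F (pow_ne_zero_int p (k + 1)) P) =
      W.baseChangeGeomPointsEquiv F (toGeomPoints (W.baseChange F) P) := by
    rw [smul_smul, ← W.zsmul_localZSMulRoot F (pow_ne_zero_int p (k + 1)) P]
    congr 1
  rw [kummerLevelClass_eq_localKummerClass W F p k P _ hroot,
    kummerLevelClass_eq_localKummerClass W F p (k + 1) P _ (W.zsmul_localZSMulRoot F (pow_ne_zero_int p (k + 1)) P),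
    WeierstrassCurve.localKummerClass, WeierstrassCurve.localKummerClass]
  change (cohomologyMap _ 1) (oneCocycleClass _ _) = _
  rw [cohomologyMap_oneCocycleClass]
  refine congrArg (oneCocycleClass _) (Subtype.ext (ContinuousMap.ext fun σ => ?_))
  rw [pullback_id_resIdHom_apply, torsionMulMor_hom_apply]
  -- compare in `E(F̄)` through the injective `pointsMap`
  apply Subtype.ext
  apply pointsMapOfEmb_injective W (closureEmb (K := K₀) F)
  change pointsMap W F ((torsionMulHom W (p ^ (k + 1)) (p ^ k) p (pow_succ p k).symm
      ((W.localKummerCocycle _ (pow_ne_zero_int p (k + 1)) (W.localZSMulRoot F (pow_ne_zero_int p (k + 1)) P) _).1 σ) :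
        geomTorsion W ((p ^ k : ℕ) : ℤ)) : geomPoints W) =
    pointsMap W F (((W.localKummerCocycle _ (pow_ne_zero_int p k)
      ((p : ℤ) • W.localZSMulRoot F (pow_ne_zero_int p (k + 1)) P) _).1 σ : geomTorsion W ((p ^ k : ℕ) : ℤ)) : geomPoints W)
  rw [coe_torsionMulHom, map_zsmul, WeierstrassCurve.pointsMap_localKummerCocycle_apply,
    WeierstrassCurve.pointsMap_localKummerCocycle_apply, smul_zsmul_localPoints, zsmul_sub]

/-! ### The pairing with points -/

variable (e : (k : ℕ) → geomTorsion W ((p ^ k : ℕ) : ℤ) → geomTorsion W ((p ^ k : ℕ) : ℤ) → AlgebraicClosure K₀)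
  (hμ : ∀ k S T, e k S T ^ (p ^ k) = 1)
  (hadd₁ : ∀ k S₁ S₂ T, e k (S₁ + S₂) T = e k S₁ T * e k S₂ T)
  (hadd₂ : ∀ k S T₁ T₂, e k S (T₁ + T₂) = e k S T₁ * e k S T₂)
  (hgal : ∀ k (σ : absoluteGaloisGroup K₀) (S T : geomTorsion W ((p ^ k : ℕ) : ℤ)),
    σ • e k S T = e k (σ • S) (σ • T))
  (hcompat : ∀ k (S T : geomTorsion W ((p ^ (k + 1) : ℕ) : ℤ)),
    e k (torsionMulHom W (p ^ (k + 1)) (p ^ k) p (pow_succ p k).symm S)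
      (torsionMulHom W (p ^ (k + 1)) (p ^ k) p (pow_succ p k).symm T) = e (k + 1) S T ^ p)

variable [CharZero F] [ValuativeRel F] [TopologicalSpace F] [IsNonarchimedeanLocalField F]

/-- **The level-`p^k` value `⟨pr_k x, κ_{p^k}(P)⟩_{p^k, inv_{p^k}} ∈ ℤ/p^k`.** [cite: NeukirchSchmidtWingberg2008, (7.2.6)] -/
def tatePointLevelValue (k : ℕ) (x : continuousCohomology 1 (restrictedTateRep W F p).toTopRep)
    (P : (W.baseChange F).toAffine.Point) : ZMod (p ^ k) :=
  levelTatePairing W F (p ^ k) (e k) (hμ k) (hadd₁ k) (hadd₂ k) (hgal k) (Prop121vii.invLevel F (p ^ k))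
    ((cohomologyMap (tateProjMor W F p k) 1).hom x) (kummerLevelClass W F p k P)

/-- Additivity of `tatePointLevelValue` in `x`. [cite: NeukirchSchmidtWingberg2008, (7.2.6)] -/
theorem tatePointLevelValue_add_left (k : ℕ) (x x' : continuousCohomology 1 (restrictedTateRep W F p).toTopRep)
    (P : (W.baseChange F).toAffine.Point) :
    tatePointLevelValue W F p e hμ hadd₁ hadd₂ hgal k (x + x') P =
      tatePointLevelValue W F p e hμ hadd₁ hadd₂ hgal k x P + tatePointLevelValue W F p e hμ hadd₁ hadd₂ hgal k x' P := by
  simp only [tatePointLevelValue, map_add, AddMonoidHom.add_apply]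

/-- Additivity of `tatePointLevelValue` in `P`. [cite: NeukirchSchmidtWingberg2008, (7.2.6)] -/
theorem tatePointLevelValue_add_right (k : ℕ) (x : continuousCohomology 1 (restrictedTateRep W F p).toTopRep)
    (P P' : (W.baseChange F).toAffine.Point) :
    tatePointLevelValue W F p e hμ hadd₁ hadd₂ hgal k x (P + P') =
      tatePointLevelValue W F p e hμ hadd₁ hadd₂ hgal k x P + tatePointLevelValue W F p e hμ hadd₁ hadd₂ hgal k x P' := by
  rw [tatePointLevelValue, tatePointLevelValue, tatePointLevelValue, kummerLevelClass_add, map_add]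

include hcompat in
/-- ★ **Coherence**: `⟨pr_{k+1} x, κ_{p^{k+1}} P⟩_{p^{k+1}} mod p^k = ⟨pr_k x, κ_{p^k} P⟩_{p^k}` (floor (b) level change + the
compatibilities of `pr_k` and `κ_{p^k}` along `p`). [cite: NeukirchSchmidtWingberg2008, (7.2.6)] [cite: SilvermanAEC2009, Prop. III.8.1 (e)] -/
theorem castHom_tatePointLevelValue_succ (k : ℕ) (x : continuousCohomology 1 (restrictedTateRep W F p).toTopRep)
    (P : (W.baseChange F).toAffine.Point) :
    ZMod.castHom (pow_dvd_pow p k.le_succ) (ZMod (p ^ k)) (tatePointLevelValue W F p e hμ hadd₁ hadd₂ hgal (k + 1) x P) =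
      tatePointLevelValue W F p e hμ hadd₁ hadd₂ hgal k x P := by
  have h := levelTatePairing_invLevel_levelChange W F (p ^ (k + 1)) (p ^ k) p (pow_succ p k).symm
    (e (k + 1)) (hμ (k + 1)) (hadd₁ (k + 1)) (hadd₂ (k + 1)) (hgal (k + 1))
    (e k) (hμ k) (hadd₁ k) (hadd₂ k) (hgal k) (hcompat k)
    ((cohomologyMap (tateProjMor W F p (k + 1)) 1).hom x) (kummerLevelClass W F p (k + 1) P)
  rw [cohomologyMap_torsionMulMor_tateProjMor, cohomologyMap_torsionMulMor_kummerLevelClass] at h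
  rw [tatePointLevelValue, tatePointLevelValue, h]

include hcompat in
/-- Existence and uniqueness of the `p`-adic integer with residues `⟨pr_k x, κ_{p^k} P⟩_{p^k}`. [cite: Serre1973, Ch. II §1] -/
theorem existsUnique_toZModPow_eq_tatePointLevelValue (x : continuousCohomology 1 (restrictedTateRep W F p).toTopRep)
    (P : (W.baseChange F).toAffine.Point) :
    ∃! z : ℤ_[p], ∀ k, PadicInt.toZModPow k z = tatePointLevelValue W F p e hμ hadd₁ hadd₂ hgal k x P := by
  have hmod : ∀ k, ((tatePointLevelValue W F p e hμ hadd₁ hadd₂ hgal (k + 1) x P).val : ℤ) ≡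
      ((tatePointLevelValue W F p e hμ hadd₁ hadd₂ hgal k x P).val : ℤ) [ZMOD (p : ℤ) ^ k] := fun k => by
    have h := castHom_tatePointLevelValue_succ W F p e hμ hadd₁ hadd₂ hgal hcompat k x P
    rw [ZMod.castHom_apply, ZMod.cast_eq_val] at h
    have h' : (((tatePointLevelValue W F p e hμ hadd₁ hadd₂ hgal (k + 1) x P).val : ℤ) : ZMod (p ^ k)) =
        (((tatePointLevelValue W F p e hμ hadd₁ hadd₂ hgal k x P).val : ℤ) : ZMod (p ^ k)) := by
      rw [Int.cast_natCast, Int.cast_natCast, h, ZMod.natCast_zmod_val]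
    have := (ZMod.intCast_eq_intCast_iff _ _ _).1 h'
    push_cast at this
    exact this
  obtain ⟨c, hc⟩ := exists_padicInt_toZModPow_eq_intCast p
    (fun k => ((tatePointLevelValue W F p e hμ hadd₁ hadd₂ hgal k x P).val : ℤ)) hmod
  refine ⟨c, fun k => ?_, fun z hz => PadicInt.ext_of_toZModPow.mp fun k => ?_⟩
  · rw [hc k, Int.cast_natCast, ZMod.natCast_zmod_val]
  · rw [hz k, hc k, Int.cast_natCast, ZMod.natCast_zmod_val]

/-- The value `⟨x, P⟩ ∈ ℤ_p` as a bare function. [cite: NeukirchSchmidtWingberg2008, (7.2.6)] -/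
def tatePairingPointFun (x : continuousCohomology 1 (restrictedTateRep W F p).toTopRep)
    (P : (W.baseChange F).toAffine.Point) : ℤ_[p] :=
  (existsUnique_toZModPow_eq_tatePointLevelValue W F p e hμ hadd₁ hadd₂ hgal hcompat x P).choose

/-- The residues of `tatePairingPointFun`. [cite: NeukirchSchmidtWingberg2008, (7.2.6)] -/
theorem toZModPow_tatePairingPointFun (k : ℕ) (x : continuousCohomology 1 (restrictedTateRep W F p).toTopRep)
    (P : (W.baseChange F).toAffine.Point) :
    PadicInt.toZModPow k (tatePairingPointFun W F p e hμ hadd₁ hadd₂ hgal hcompat x P) =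
      tatePointLevelValue W F p e hμ hadd₁ hadd₂ hgal k x P :=
  (existsUnique_toZModPow_eq_tatePointLevelValue W F p e hμ hadd₁ hadd₂ hgal hcompat x P).choose_spec.1 k

/-- ★★ **The `ℤ_p`-valued local Tate pairing of `H¹(F, T_pW)` with `E(F)`**, `⟨x, P⟩ := (⟨pr_k x, κ_{p^k}(P)⟩_{p^k, inv_{p^k}})_k
∈ lim ℤ/p^k = ℤ_p` — the pairing `⟨x, κ(P)⟩` of Kato II §1.4 / Bloch–Kato §3 Prop. 3.8 (the Kummer image paired by local Tate
duality), bi-additive. [cite: Kato1993LNM1553, Ch. II §1.4] [cite: BlochKato1990, Prop. 3.8 (p. 354)] [cite: NeukirchSchmidtWingberg2008, (7.2.6)] -/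
def tatePairingPoint :
    continuousCohomology 1 (restrictedTateRep W F p).toTopRep →+ (W.baseChange F).toAffine.Point →+ ℤ_[p] :=
  AddMonoidHom.mk' (fun x => AddMonoidHom.mk' (fun P => tatePairingPointFun W F p e hμ hadd₁ hadd₂ hgal hcompat x P)
      fun P P' => PadicInt.ext_of_toZModPow.mp fun k => by
        rw [map_add, toZModPow_tatePairingPointFun, toZModPow_tatePairingPointFun, toZModPow_tatePairingPointFun,
          tatePointLevelValue_add_right])
    fun x x' => AddMonoidHom.ext fun P => PadicInt.ext_of_toZModPow.mp fun k => by
      rw [AddMonoidHom.mk'_apply, AddMonoidHom.add_apply, AddMonoidHom.mk'_apply, AddMonoidHom.mk'_apply, map_add,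
        toZModPow_tatePairingPointFun, toZModPow_tatePairingPointFun, toZModPow_tatePairingPointFun,
        tatePointLevelValue_add_left]

/-- ★ **Residues**: `⟨x, P⟩ mod p^k = ⟨pr_k x, κ_{p^k}(P)⟩_{p^k, inv_{p^k}}`. [cite: NeukirchSchmidtWingberg2008, (7.2.6)] -/
theorem toZModPow_tatePairingPoint (k : ℕ) (x : continuousCohomology 1 (restrictedTateRep W F p).toTopRep)
    (P : (W.baseChange F).toAffine.Point) :
    PadicInt.toZModPow k (tatePairingPoint W F p e hμ hadd₁ hadd₂ hgal hcompat x P) =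
      levelTatePairing W F (p ^ k) (e k) (hμ k) (hadd₁ k) (hadd₂ k) (hgal k) (Prop121vii.invLevel F (p ^ k))
        ((cohomologyMap (tateProjMor W F p k) 1).hom x) (kummerLevelClass W F p k P) :=
  toZModPow_tatePairingPointFun W F p e hμ hadd₁ hadd₂ hgal hcompat k x P

/-- **Comparison with the pairing of classes**: if `y ∈ H¹(F, T_pW)` is a `T`-adic Kummer class of `P` (all its projections
are the level Kummer classes of `P`), then `⟨x, y⟩ = ⟨x, P⟩`. [cite: BlochKato1990, Prop. 3.8 (p. 354)] -/
theorem tatePairing_eq_tatePairingPoint (x y : continuousCohomology 1 (restrictedTateRep W F p).toTopRep)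
    (P : (W.baseChange F).toAffine.Point)
    (hy : ∀ k, (cohomologyMap (tateProjMor W F p k) 1).hom y = kummerLevelClass W F p k P) :
    tatePairing W F p e hμ hadd₁ hadd₂ hgal hcompat x y = tatePairingPoint W F p e hμ hadd₁ hadd₂ hgal hcompat x P :=
  PadicInt.ext_of_toZModPow.mp fun k => by
    rw [toZModPow_tatePairing, toZModPow_tatePairingPoint, hy k]

end Literature.NumberTheory.EllipticCurves

end
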